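import Literature.Geometry.Lorentzian.CarterThresholdBarrier
import HarnessLib

/-!
# Carter's coefficient along the threshold barrier: the exact profile `Δ·J + W₁`, two-sided bounds,
# and the linear behaviour of `J` (rates for the tunnelling estimates in BF-stable sectors)
(namespace `Literature.Geometry.Lorentzian.Kerr`.)

Carter's radial equation `u″ + φu = 0`, `φ = ω² − V∘ρ` (`V = Kerr.sepPotential M a ω m Λ`; DRSR
arXiv:1402.7034 §5.2.3), AT THE SUPERRADIANT THRESHOLD `ω = mω₊` of a sub-extremal Kerr exterior
(`|a| < M`). With `Λ′ = Λ − 2amω`, `Δ = (r − r₊)(r − r₋)`, `K = ω(r² − r₊²)`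
(`Kerr.Costa2019.radialK_eq_of_threshold`) and `W₁ = (r² + a²)²V₁ ∈ [0, 3Δ]`
(`Kerr.sq_mul_sepPotential₁_le`), the identity `(r² + a²)²(ω² − V) = K² − ΔΛ′ − W₁`
(`Kerr.sq_mul_coeff_eq`) becomes the EXACT profile of the barrier coefficient `q := V − ω² = −φ`:

  `(r² + a²)²·q(r) = Δ(r)·J(r) + W₁(r)`,  `J(r) := Λ′ − ω²(r + r₊)²·(r − r₊)/(r − r₋)`

(since `K² = ω²(r + r₊)²(r − r₊)² = Δ·ω²(r + r₊)²(r − r₊)/(r − r₋)`). The "threshold profile" `J` is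
kept as this explicit expression (no definition is introduced); all statements are for `r > r₊`:

* `sq_mul_negCoeff_eq_of_threshold` — the exact profile; `sq_mul_negCoeff_mem_Icc_of_threshold` —
  the two-sided bounds `Δ·J ≤ (r² + a²)²·q ≤ Δ·(J + 3)`;
* `thresholdProfile_ge`, `thresholdProfile_le` — `J(r) ≥ Λ′ − ω²(r + r₊)²` (the `r`-form barrier
  `ω²(r + r₊)² ≤ Λ′` lies inside `{J ≥ 0}`), and `J(r) ≤ Λ′ − ½ω²(r + r₊)²` once `r − r₊ ≥ r₊ − r₋`;
* `thresholdProfile_sub_ge`, `thresholdProfile_sub_le` — LINEAR two-sided control: for `r₊ < r ≤ r′`,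
  `2ω²(r + r₊)h(r)·(r′ − r) ≤ J(r) − J(r′) ≤ ω²(2(r′ + r₊) + (r′ + r₊)²/(r − r₋))·(r′ − r)`,
  `h = (r − r₊)/(r − r₋)` (from `J′ = −ω²[2(r + r₊)h + (r + r₊)²h′]`, `h′ = (r₊ − r₋)/(r − r₋)² ≥ 0`);
  in particular `J` is strictly decreasing for `ω ≠ 0` (`thresholdProfile_lt`): ONE `r`-form turning
  point `r_t′` of `Δ·J`, and `J(r) ≍ (r_t′ − r)` linearly and explicitly near it.

These are the explicit rate inputs (`q ≥ k²` on sub-barriers; non-degenerate, linear far turning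
point) of the threshold tunnelling estimates of the near-extremal Kerr programme (crux
`KappaExplicitWaveDecay`, BF-stable large-`Λ` kernel bound). Not here: anything off the threshold, and
the location of the true turning point `ρ b₂ ∈ [r_t′, r_t′ + O(1/Λ′)]` (census + `W₁ ≤ 3Δ`).

## References
* M. Dafermos, I. Rodnianski, Y. Shlapentokh-Rothman, arXiv:1402.7034 = Ann. of Math. 183 (2016),
  §§5.2.3, 6.2 (key `DafermosRodnianskiShlapentokhrothman2014`).
* R. Teixeira da Costa, Commun. Math. Phys. 378 (2020), §2.2 (key `Costa2019`). The algebra is folklore.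
-/

noncomputable section

open Set

namespace Literature.Geometry.Lorentzian

namespace Kerr

section Threshold

variable {M a ω Λ : ℝ} {m : ℤ}

/-! ### The exact form of the coefficient -/

/-- **Exact profile of Carter's coefficient at the threshold**: for `|a| < M`, `ω = mω₊`, `r > r₊`:
`(r² + a²)²(V(r) − ω²) = Δ(r)·J(r) + (r² + a²)²V₁(r)`, `J(r) = Λ − 2amω − ω²(r + r₊)²(r − r₊)/(r − r₋)`.
[folklore] -/
theorem sq_mul_negCoeff_eq_of_threshold (ha : |a| < M) (hω : ω = m * horizonAngularVelocity M a)
    {r : ℝ} (hr : rPlus M a < r) :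
    (r ^ 2 + a ^ 2) ^ 2 * (sepPotential M a ω m Λ r - ω ^ 2) =
      delta M a r *
          (Λ - 2 * a * m * ω - ω ^ 2 * (r + rPlus M a) ^ 2 * ((r - rPlus M a) / (r - rMinus M a))) +
        (r ^ 2 + a ^ 2) ^ 2 * sepPotential₁ M a r := by
  have hM : 0 < M := lt_of_le_of_lt (abs_nonneg a) ha
  have hrp : 0 < rPlus M a := rPlus_pos hM a
  have hr0 : 0 < r := hrp.trans hr
  have hA : r ^ 2 + a ^ 2 ≠ 0 := by positivity
  have hsub : IsSubextremal M a := ha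
  have hrm : 0 < r - rMinus M a := by linarith [hsub.rMinus_lt_rPlus]
  have h := sq_mul_coeff_eq M a ω m Λ hA
  have hK : radialK a ω m r = ω * (r ^ 2 - rPlus M a ^ 2) :=
    Costa2019.radialK_eq_of_threshold ha hω r
  have hΔ : delta M a r = (r - rPlus M a) * (r - rMinus M a) := delta_eq_mul ha.le r
  have hK2 : radialK a ω m r ^ 2 =
      delta M a r * (ω ^ 2 * (r + rPlus M a) ^ 2 * ((r - rPlus M a) / (r - rMinus M a))) := by
    rw [hK, hΔ]; field_simp; ring
  linear_combination -h - hK2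

/-- **Two-sided bounds**: for `|a| < M`, `ω = mω₊`, `r > r₊`:
`Δ·J ≤ (r² + a²)²(V − ω²) ≤ Δ·(J + 3)` (`0 ≤ (r² + a²)²V₁ ≤ 3Δ`). [folklore] -/
theorem sq_mul_negCoeff_mem_Icc_of_threshold (ha : |a| < M)
    (hω : ω = m * horizonAngularVelocity M a) {r : ℝ} (hr : rPlus M a < r) :
    delta M a r *
          (Λ - 2 * a * m * ω - ω ^ 2 * (r + rPlus M a) ^ 2 * ((r - rPlus M a) / (r - rMinus M a))) ≤
        (r ^ 2 + a ^ 2) ^ 2 * (sepPotential M a ω m Λ r - ω ^ 2) ∧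
      (r ^ 2 + a ^ 2) ^ 2 * (sepPotential M a ω m Λ r - ω ^ 2) ≤
        delta M a r *
          (Λ - 2 * a * m * ω - ω ^ 2 * (r + rPlus M a) ^ 2 * ((r - rPlus M a) / (r - rMinus M a)) +
            3) := by
  have hM : 0 < M := lt_of_le_of_lt (abs_nonneg a) ha
  rw [sq_mul_negCoeff_eq_of_threshold ha hω hr]
  have h1 : 0 ≤ (r ^ 2 + a ^ 2) ^ 2 * sepPotential₁ M a r :=
    mul_nonneg (sq_nonneg _) (sepPotential₁_nonneg ha.le hr.le)
  have h2 := sq_mul_sepPotential₁_le hM ha.le hr.le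
  constructor <;> nlinarith

/-- `J(r) ≥ Λ′ − ω²(r + r₊)²` for `r > r₊` (`0 ≤ (r − r₊)/(r − r₋) ≤ 1`): the `r`-form barrier
`ω²(r + r₊)² ≤ Λ′` lies inside `{J ≥ 0}`. [folklore] -/
theorem thresholdProfile_ge (ha : |a| < M) {r : ℝ} (hr : rPlus M a < r) :
    Λ - 2 * a * m * ω - ω ^ 2 * (r + rPlus M a) ^ 2 ≤
      Λ - 2 * a * m * ω - ω ^ 2 * (r + rPlus M a) ^ 2 * ((r - rPlus M a) / (r - rMinus M a)) := by
  have hsub : IsSubextremal M a := ha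
  have hrm : 0 < r - rMinus M a := by linarith [hsub.rMinus_lt_rPlus]
  have hh : (r - rPlus M a) / (r - rMinus M a) ≤ 1 := by
    rw [div_le_one hrm]; linarith [hsub.rMinus_lt_rPlus]
  have h0 : 0 ≤ ω ^ 2 * (r + rPlus M a) ^ 2 := by positivity
  nlinarith [mul_le_mul_of_nonneg_left hh h0]

/-- `J(r) ≤ Λ′ − ½ω²(r + r₊)²` once `r − r₊ ≥ r₊ − r₋` (then `(r − r₊)/(r − r₋) ≥ ½`): beyond one
horizon width the profile is within a factor two of the `r`-form one. [folklore] -/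
theorem thresholdProfile_le (ha : |a| < M) {r : ℝ} (hr : rPlus M a - rMinus M a ≤ r - rPlus M a) :
    Λ - 2 * a * m * ω - ω ^ 2 * (r + rPlus M a) ^ 2 * ((r - rPlus M a) / (r - rMinus M a)) ≤
      Λ - 2 * a * m * ω - ω ^ 2 * (r + rPlus M a) ^ 2 / 2 := by
  have hsub : IsSubextremal M a := ha
  have hd : 0 < rPlus M a - rMinus M a := sub_pos.2 hsub.rMinus_lt_rPlus
  have hrm : 0 < r - rMinus M a := by linarith
  have hh : 1 / 2 ≤ (r - rPlus M a) / (r - rMinus M a) := by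
    rw [le_div_iff₀ hrm]; linarith
  have h0 : 0 ≤ ω ^ 2 * (r + rPlus M a) ^ 2 := by positivity
  nlinarith [mul_le_mul_of_nonneg_left hh h0]

/-! ### The slope of the profile (private calculus) and its linear two-sided control -/

/-- The derivative of the profile: `J′(r) = −ω²[2(r + r₊)h + (r + r₊)²h′]`, `h = (r − r₊)/(r − r₋)`,
`h′ = (r₊ − r₋)/(r − r₋)²`, at every `r > r₊`. [folklore] -/
private theorem hasDerivAt_thresholdProfile (ha : |a| < M) {r : ℝ} (hr : rPlus M a < r) :
    HasDerivAt
      (fun s : ℝ ↦ Λ - 2 * a * m * ω - ω ^ 2 * (s + rPlus M a) ^ 2 * ((s - rPlus M a) / (s - rMinus M a)))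
      (-(ω ^ 2 * (2 * (r + rPlus M a) * ((r - rPlus M a) / (r - rMinus M a)) +
        (r + rPlus M a) ^ 2 * ((rPlus M a - rMinus M a) / (r - rMinus M a) ^ 2)))) r := by
  have hsub : IsSubextremal M a := ha
  have hrm : r - rMinus M a ≠ 0 := by linarith [hsub.rMinus_lt_rPlus]
  have h1 : HasDerivAt ((fun s : ℝ ↦ s + rPlus M a) ^ 2) (2 * (r + rPlus M a)) r := by
    simpa using ((hasDerivAt_id r).add_const (rPlus M a)).pow 2
  have h2 : HasDerivAt (fun s : ℝ ↦ (s - rPlus M a) / (s - rMinus M a))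
      ((rPlus M a - rMinus M a) / (r - rMinus M a) ^ 2) r := by
    have e1 : HasDerivAt (fun s : ℝ ↦ s - rPlus M a) 1 r := (hasDerivAt_id r).sub_const _
    have e2 : HasDerivAt (fun s : ℝ ↦ s - rMinus M a) 1 r := (hasDerivAt_id r).sub_const _
    refine (e1.div e2 hrm).congr_deriv ?_
    field_simp
    ring
  have h3 := ((h1.mul h2).const_mul (ω ^ 2)).const_sub (Λ - 2 * a * m * ω)
  have e : (fun s : ℝ ↦ Λ - 2 * a * m * ω -
      ω ^ 2 * (s + rPlus M a) ^ 2 * ((s - rPlus M a) / (s - rMinus M a))) = fun x ↦ Λ - 2 * a * m * ω -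
      ω ^ 2 * (((fun s : ℝ ↦ s + rPlus M a) ^ 2) * fun s ↦ (s - rPlus M a) / (s - rMinus M a)) x := by
    funext x
    simp only [Pi.mul_apply, Pi.pow_apply]
    ring
  rw [e]
  exact h3.congr_deriv (by simp only [Pi.pow_apply])

/-- **Linear lower bound of the profile towards a larger radius**: for `r₊ < r ≤ r′` (`|a| < M`),
`2ω²(r + r₊)·(r − r₊)/(r − r₋)·(r′ − r) ≤ J(r) − J(r′)` — the lower slope bound
`−J′(s) ≥ 2ω²(s + r₊)h(s) ≥ 2ω²(r + r₊)h(r)` on `[r, r′]` (`h` non-decreasing). In particular, if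
`J(r′) ≥ 0` (e.g. `r′` the turning point) then `J(r) ≥ 2ω²(r + r₊)h(r)·(r′ − r)`. [folklore] -/
theorem thresholdProfile_sub_ge (ha : |a| < M) {r r' : ℝ} (hr : rPlus M a < r) (hrr' : r ≤ r') :
    2 * ω ^ 2 * (r + rPlus M a) * ((r - rPlus M a) / (r - rMinus M a)) * (r' - r) ≤
      (Λ - 2 * a * m * ω - ω ^ 2 * (r + rPlus M a) ^ 2 * ((r - rPlus M a) / (r - rMinus M a))) -
        (Λ - 2 * a * m * ω - ω ^ 2 * (r' + rPlus M a) ^ 2 * ((r' - rPlus M a) / (r' - rMinus M a))) := by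
  have hM : 0 < M := lt_of_le_of_lt (abs_nonneg a) ha
  have hrp : 0 < rPlus M a := rPlus_pos hM a
  have hsub : IsSubextremal M a := ha
  rcases hrr'.eq_or_lt with h | hlt
  · subst h; simp
  set J : ℝ → ℝ := fun s ↦ Λ - 2 * a * m * ω -
    ω ^ 2 * (s + rPlus M a) ^ 2 * ((s - rPlus M a) / (s - rMinus M a)) with hJdef
  set c := 2 * ω ^ 2 * (r + rPlus M a) * ((r - rPlus M a) / (r - rMinus M a)) with hc
  -- `G(s) = J(s) + c·s` is non-increasing on `[r, r']`
  have hG' : ∀ s ∈ Icc r r', HasDerivAt (fun s ↦ J s + c * s)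
      (-(ω ^ 2 * (2 * (s + rPlus M a) * ((s - rPlus M a) / (s - rMinus M a)) +
        (s + rPlus M a) ^ 2 * ((rPlus M a - rMinus M a) / (s - rMinus M a) ^ 2))) + c) s := by
    intro s hs
    have h := (hasDerivAt_thresholdProfile (ω := ω) (Λ := Λ) (m := m) ha (hr.trans_le hs.1)).add
      ((hasDerivAt_id s).const_mul c)
    simp only [id, mul_one] at h
    exact h
  have hG : AntitoneOn (fun s ↦ J s + c * s) (Icc r r') := by
    refine antitoneOn_of_deriv_nonpos (convex_Icc r r')
      (fun s hs ↦ (hG' s hs).continuousAt.continuousWithinAt)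
      (fun s hs ↦ (hG' s (interior_subset hs)).differentiableAt.differentiableWithinAt)
      fun s hs ↦ ?_
    rw [interior_Icc] at hs
    rw [(hG' s (Ioo_subset_Icc_self hs)).deriv]
    -- `c ≤ 2ω²(s + r₊)h(s)` and the `h′`-term is non-negative
    have hsm : 0 < s - rMinus M a := by linarith [hsub.rMinus_lt_rPlus, hs.1]
    have hrm : 0 < r - rMinus M a := by linarith [hsub.rMinus_lt_rPlus]
    have hh : (r - rPlus M a) / (r - rMinus M a) ≤ (s - rPlus M a) / (s - rMinus M a) := by
      rw [div_le_div_iff₀ hrm hsm]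
      nlinarith [hs.1, hsub.rMinus_lt_rPlus]
    have hh0 : 0 ≤ (r - rPlus M a) / (r - rMinus M a) := div_nonneg (by linarith) hrm.le
    have hω2 : 0 ≤ ω ^ 2 := sq_nonneg ω
    have hc' : c ≤ ω ^ 2 * (2 * (s + rPlus M a) * ((s - rPlus M a) / (s - rMinus M a))) := by
      rw [hc]
      calc 2 * ω ^ 2 * (r + rPlus M a) * ((r - rPlus M a) / (r - rMinus M a))
          ≤ 2 * ω ^ 2 * (s + rPlus M a) * ((r - rPlus M a) / (r - rMinus M a)) := by
            apply mul_le_mul_of_nonneg_right _ hh0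
            exact mul_le_mul_of_nonneg_left (by linarith [hs.1]) (by positivity)
        _ ≤ 2 * ω ^ 2 * (s + rPlus M a) * ((s - rPlus M a) / (s - rMinus M a)) := by
            apply mul_le_mul_of_nonneg_left hh
            exact mul_nonneg (by positivity) (by linarith [hs.1])
        _ = ω ^ 2 * (2 * (s + rPlus M a) * ((s - rPlus M a) / (s - rMinus M a))) := by ring
    have hpos : 0 ≤ ω ^ 2 * ((s + rPlus M a) ^ 2 * ((rPlus M a - rMinus M a) / (s - rMinus M a) ^ 2)) :=
      mul_nonneg hω2 (mul_nonneg (sq_nonneg _)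
        (div_nonneg (sub_nonneg.2 (rMinus_le_rPlus M a)) (sq_nonneg _)))
    nlinarith
  have key := hG (left_mem_Icc.2 hlt.le) (right_mem_Icc.2 hlt.le) hlt.le
  simp only [hJdef] at key
  linarith

/-- **Linear upper bound of the profile towards a larger radius**: for `r₊ < r ≤ r′` (`|a| < M`),
`J(r) − J(r′) ≤ ω²·(2(r′ + r₊) + (r′ + r₊)²/(r − r₋))·(r′ − r)` — the upper slope bound
`−J′(s) ≤ ω²(2(s + r₊) + (s + r₊)²/(s − r₋))` on `[r, r′]`. [folklore] -/
theorem thresholdProfile_sub_le (ha : |a| < M) {r r' : ℝ} (hr : rPlus M a < r) (hrr' : r ≤ r') :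
    (Λ - 2 * a * m * ω - ω ^ 2 * (r + rPlus M a) ^ 2 * ((r - rPlus M a) / (r - rMinus M a))) -
        (Λ - 2 * a * m * ω - ω ^ 2 * (r' + rPlus M a) ^ 2 * ((r' - rPlus M a) / (r' - rMinus M a))) ≤
      ω ^ 2 * (2 * (r' + rPlus M a) + (r' + rPlus M a) ^ 2 / (r - rMinus M a)) * (r' - r) := by
  have hM : 0 < M := lt_of_le_of_lt (abs_nonneg a) ha
  have hrp : 0 < rPlus M a := rPlus_pos hM a
  have hsub : IsSubextremal M a := ha
  rcases hrr'.eq_or_lt with h | hlt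
  · subst h; simp
  set J : ℝ → ℝ := fun s ↦ Λ - 2 * a * m * ω -
    ω ^ 2 * (s + rPlus M a) ^ 2 * ((s - rPlus M a) / (s - rMinus M a)) with hJdef
  set C := ω ^ 2 * (2 * (r' + rPlus M a) + (r' + rPlus M a) ^ 2 / (r - rMinus M a)) with hC
  -- `G(s) = J(s) + C·s` is non-decreasing on `[r, r']`
  have hG' : ∀ s ∈ Icc r r', HasDerivAt (fun s ↦ J s + C * s)
      (-(ω ^ 2 * (2 * (s + rPlus M a) * ((s - rPlus M a) / (s - rMinus M a)) +
        (s + rPlus M a) ^ 2 * ((rPlus M a - rMinus M a) / (s - rMinus M a) ^ 2))) + C) s := by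
    intro s hs
    have h := (hasDerivAt_thresholdProfile (ω := ω) (Λ := Λ) (m := m) ha (hr.trans_le hs.1)).add
      ((hasDerivAt_id s).const_mul C)
    simp only [id, mul_one] at h
    exact h
  have hG : MonotoneOn (fun s ↦ J s + C * s) (Icc r r') := by
    refine monotoneOn_of_deriv_nonneg (convex_Icc r r')
      (fun s hs ↦ (hG' s hs).continuousAt.continuousWithinAt)
      (fun s hs ↦ (hG' s (interior_subset hs)).differentiableAt.differentiableWithinAt)
      fun s hs ↦ ?_
    rw [interior_Icc] at hs
    rw [(hG' s (Ioo_subset_Icc_self hs)).deriv]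
    have hsm : 0 < s - rMinus M a := by linarith [hsub.rMinus_lt_rPlus, hs.1]
    have hrm : 0 < r - rMinus M a := by linarith [hsub.rMinus_lt_rPlus]
    have hω2 : 0 ≤ ω ^ 2 := sq_nonneg ω
    have hh1 : (s - rPlus M a) / (s - rMinus M a) ≤ 1 := by
      rw [div_le_one hsm]; linarith [hsub.rMinus_lt_rPlus]
    have hsr : 0 ≤ s + rPlus M a := by linarith [hs.1]
    -- first term `≤ 2(r' + r₊)`
    have e1 : 2 * (s + rPlus M a) * ((s - rPlus M a) / (s - rMinus M a)) ≤ 2 * (r' + rPlus M a) := by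
      calc 2 * (s + rPlus M a) * ((s - rPlus M a) / (s - rMinus M a))
          ≤ 2 * (s + rPlus M a) * 1 := mul_le_mul_of_nonneg_left hh1 (by positivity)
        _ ≤ 2 * (r' + rPlus M a) := by linarith [hs.2]
    -- second term `≤ (r' + r₊)²/(r − r₋)`
    have e2 : (s + rPlus M a) ^ 2 * ((rPlus M a - rMinus M a) / (s - rMinus M a) ^ 2) ≤
        (r' + rPlus M a) ^ 2 / (r - rMinus M a) := by
      have f1 : (s + rPlus M a) ^ 2 ≤ (r' + rPlus M a) ^ 2 :=
        pow_le_pow_left₀ hsr (by linarith [hs.2]) 2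
      have f2 : (rPlus M a - rMinus M a) / (s - rMinus M a) ^ 2 ≤ 1 / (r - rMinus M a) := by
        rw [div_le_div_iff₀ (by positivity) hrm, one_mul, sq]
        calc (rPlus M a - rMinus M a) * (r - rMinus M a)
            ≤ (s - rMinus M a) * (r - rMinus M a) :=
              mul_le_mul_of_nonneg_right (by linarith [hs.1]) hrm.le
          _ ≤ (s - rMinus M a) * (s - rMinus M a) :=
              mul_le_mul_of_nonneg_left (by linarith [hs.1]) hsm.le
      calc (s + rPlus M a) ^ 2 * ((rPlus M a - rMinus M a) / (s - rMinus M a) ^ 2)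
          ≤ (r' + rPlus M a) ^ 2 * (1 / (r - rMinus M a)) :=
            mul_le_mul f1 f2 (div_nonneg (sub_nonneg.2 (rMinus_le_rPlus M a)) (sq_nonneg _))
              (sq_nonneg _)
        _ = (r' + rPlus M a) ^ 2 / (r - rMinus M a) := by ring
    have e3 : ω ^ 2 * (2 * (s + rPlus M a) * ((s - rPlus M a) / (s - rMinus M a)) +
        (s + rPlus M a) ^ 2 * ((rPlus M a - rMinus M a) / (s - rMinus M a) ^ 2)) ≤ C := by
      rw [hC]; exact mul_le_mul_of_nonneg_left (add_le_add e1 e2) hω2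
    linarith
  have key := hG (left_mem_Icc.2 hlt.le) (right_mem_Icc.2 hlt.le) hlt.le
  simp only [hJdef] at key
  linarith

/-- **The profile is strictly decreasing** on `(r₊, ∞)` for `ω ≠ 0` (`|a| < M`): for
`r₊ < r < r′`, `J(r′) < J(r)` — the threshold barrier has ONE `r`-form turning point. [folklore] -/
theorem thresholdProfile_lt (ha : |a| < M) (hω : ω ≠ 0) {r r' : ℝ} (hr : rPlus M a < r)
    (hrr' : r < r') :
    Λ - 2 * a * m * ω - ω ^ 2 * (r' + rPlus M a) ^ 2 * ((r' - rPlus M a) / (r' - rMinus M a)) <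
      Λ - 2 * a * m * ω - ω ^ 2 * (r + rPlus M a) ^ 2 * ((r - rPlus M a) / (r - rMinus M a)) := by
  have hM : 0 < M := lt_of_le_of_lt (abs_nonneg a) ha
  have hrp : 0 < rPlus M a := rPlus_pos hM a
  have hsub : IsSubextremal M a := ha
  have h := thresholdProfile_sub_ge (ω := ω) (Λ := Λ) (m := m) ha hr hrr'.le
  have hrm : 0 < r - rMinus M a := by linarith [hsub.rMinus_lt_rPlus]
  have hpos : 0 < 2 * ω ^ 2 * (r + rPlus M a) * ((r - rPlus M a) / (r - rMinus M a)) * (r' - r) := by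
    have hω2 : 0 < ω ^ 2 := by positivity
    have hh : 0 < (r - rPlus M a) / (r - rMinus M a) := div_pos (by linarith) hrm
    have hrr : 0 < r + rPlus M a := by linarith
    exact mul_pos (mul_pos (mul_pos (mul_pos (by norm_num) hω2) hrr) hh) (by linarith)
  linarith

end Threshold

end Kerr

end Literature.Geometry.Lorentzian

end
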